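import Summits.AnomalousDissipation.AnomalousDissipation.Theorems.MarginalStabilityChainStrainedLayerLawStubVorticityUniformBoundsS
import Summits.AnomalousDissipation.AnomalousDissipation.Theorems.MarginalStabilityChainStrainedLayerLawStubVorticityUniformBoundsR
import Summits.AnomalousDissipation.AnomalousDissipation.Theorems.MarginalStabilityChainStrainedLayerLawStubVorticityUniformBoundsQ
import Summits.AnomalousDissipation.AnomalousDissipation.Theorems.MarginalStabilityChainStrainedLayerLawStubVorticityUniformBoundsN

/-!
# Stub `stub_vorticityUniformBounds` (crux stmt-AnomalousDissipation-3007, line `strain-work-sum-rule`) — tools U: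
# the uniform-in-time first-moment bound

Support file (`--supports stmt-AnomalousDissipation-3007`; registered sub-goal `stub_vorticityUniformBounds_moment`), step
(b′) of the a-priori chain, PROVED: `∃ M, ∀ t ≥ 1, ∫_{(0,L]}∫_ℝ |y||ω(t)| ≤ M`. With `φ = √(1+y²) ≥ |y|`, the regularised
cut-off moment `f(τ) = ∫∫ j_ε(ω)φψ_R` is differentiable (tools S), and by the moment balance (tools R), Kato
(`‖ω‖₁ ≤ A₀`, tools H), the enstrophy bound (tools N), `‖v‖₂ ≤ (L/2π)‖ω‖₂` (tools Q) and the tails (errors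
`a/R + εb(R) ≤ 1` for `R ≥ 2a`, `ε` small), `f′ ≤ −f + K₀ + 1` with `K₀ = (L/2π)B + (1 + ν)A₀`; the barrier on
`[1, t]` bounds `f(t)` by `max(f(1), K₀ + 1) ≤ max(∫∫|ω(1)|φ + 1, K₀ + 1)`, and `R → ∞`. All `[folklore]`.
-/

-- `Summit.<Summit>.<Problem>` is the tree's mandated summit-side namespace (CONVENTIONS §2); for this
-- single-conjunct summit the two coincide, so the duplicate is deliberate.
set_option linter.dupNamespace false

noncomputable section

open scoped Topology ENNReal
open Filter Set Function MeasureTheory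

namespace Summit.AnomalousDissipation.AnomalousDissipation.Theorems.StrainedLayerLaw.StrainWorkSumRule

open Literature.Analysis.FluidPDE Literature.Analysis.FluidPDE.StretchedLayer
open Summit.AnomalousDissipation.AnomalousDissipation.Theorems.MarginalStabilityChainStretchedVortexRows

/-! ## The uniform first-moment bound -/

section Moment

set_option maxHeartbeats 400000 in
/-- **Uniform-in-time bound for the first `y`-moment of the vorticity (registered sub-goal
`stub_vorticityUniformBounds_moment`).** For every classical solution of the stretched layer system on `(0,∞)`
(`ν, L > 0`) with uniform exponential shear tails on compact time intervals there is `M` with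
`∫_{(0,L]} ∫_ℝ |y||ω(t)| ≤ M` for all `t ≥ 1` — step (b′) of the a-priori chain: with `φ = √(1+y²) ≥ |y|`, the
regularised, cut-off moment `f(τ) = ∫∫ j_ε(ω)φψ_R` is differentiable (tools S) and, by the moment balance (tools R)
together with Kato (`‖ω‖₁ ≤ A₀`), the enstrophy bound (`‖ω‖₂² ≤ B`, tools N), `‖v‖₂ ≤ (L/2π)‖ω‖₂` (tools Q) and the
tails (the cutoff errors are `a/R + εb(R)`), `f′ ≤ −f + K₀ + 1`; the barrier on `[1, t]` bounds `f(t)`, and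
`R → ∞`. [folklore] -/
theorem stub_vorticityUniformBounds_moment : ∀ (ν L : ℝ), 0 < ν → 0 < L → ∀ (u v p : ℝ → ℝ → ℝ → ℝ),
    IsStretchedLayerNSSolutionOn (Ioi 0) ν 1 1 L u v p →
    (∀ a b : ℝ, 0 < a → a < b → ExpTails (Icc a b) u v) →
      ∃ M : ℝ, ∀ t : ℝ, 1 ≤ t → (∫ x in Ioc 0 L, ∫ y, |y| * |vorticity (u t) (v t) x y|) ≤ M := by
  obtain ⟨kato_sq_add_sq_pos, kato_sqrt_pos, kato_le_sqrt, kato_abs_le_sqrt, kato_sqrt_le, kato_abs_jprime_le_one,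
    kato_jsecond_nonneg, kato_G_nonpos, kato_mul_jprime_sub_G, kato_hasDerivAt_j, kato_hasDerivAt_jprime,
    kato_hasDerivAt_G⟩ := kato_modulus_props
  intro ν L hν hL u v p hsol htails
  obtain ⟨kato_phi_pos, kato_abs_le_phi, kato_phi_le, kato_abs_phi'_le, kato_phi''_le, kato_mul_phi', kato_phi_contDiff,
    kato_phi'_contDiff, kato_phi_ge_one, kato_phi_sq, kato_hasDerivAt_phi, kato_hasDerivAt_phi'⟩ := kato_phi_props
  set ω : ℝ → ℝ → ℝ → ℝ := fun τ => vorticity (u τ) (v τ) with hωdef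
  have hS : MeasurableSet (Ioc (0:ℝ) L ×ˢ (univ : Set ℝ)) := measurableSet_Ioc.prod MeasurableSet.univ
  have hle1 : ∀ {k : ℝ} (y : ℝ), 0 < k → Real.exp (-k * |y|) ≤ 1 := fun y hk =>
    Real.exp_le_one_iff.2 (by nlinarith [abs_nonneg y])
  have cω : ∀ {τ : ℝ}, 0 < τ → Continuous fun q : ℝ × ℝ => ω τ q.1 q.2 := fun hτ =>
    (contDiff_one_vorticity (hsol.contDiff_u (mem_Ioi.2 hτ)) (hsol.contDiff_v (mem_Ioi.2 hτ))).continuous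
  -- slice facts from the tails on `[a, b]`
  have hfacts : ∀ {a b τ : ℝ}, 0 < a → a < b → τ ∈ Icc a b → ∃ C k : ℝ, 0 < k ∧ 0 ≤ C ∧
      SliceTails C k (u τ) (v τ) ∧ (∀ x y, |ω τ x y| ≤ C * Real.exp (-k * |y|)) ∧
      IntegrableOn (fun q : ℝ × ℝ => |ω τ q.1 q.2|) (Ioc 0 L ×ˢ univ) ∧
      IntegrableOn (fun q : ℝ × ℝ => ω τ q.1 q.2 ^ 2) (Ioc 0 L ×ˢ univ) ∧
      IntegrableOn (fun q : ℝ × ℝ => |ω τ q.1 q.2| * Real.sqrt (1 + q.2 ^ 2)) (Ioc 0 L ×ˢ univ) := by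
    intro a b τ ha hab hτ
    obtain ⟨C, k, hk, hCk⟩ := htails a b ha hab
    have hT : SliceTails C k (u τ) (v τ) := (hCk τ hτ).1
    have hC : 0 ≤ C := hT.nonneg
    have hτ0 : 0 < τ := ha.trans_le hτ.1
    have hωb : ∀ x y, |ω τ x y| ≤ C * Real.exp (-k * |y|) := tails_abs_vorticity_le hT
    refine ⟨C, k, hk, hC, hT, hωb, ?_, ?_, ?_⟩
    · exact integrableOn_strip_of_abs_le_exp (cω hτ0).abs hC hk fun x _ y => by rw [abs_abs]; exact hωb x y
    · refine integrableOn_strip_of_abs_le_exp ((cω hτ0).pow 2) (by positivity : 0 ≤ C ^ 2) hk fun x _ y => ?_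
      rw [abs_of_nonneg (sq_nonneg _)]
      have h1 := hωb x y
      have h2 : |ω τ x y| ≤ C := h1.trans (mul_le_of_le_one_right hC (hle1 y hk))
      calc ω τ x y ^ 2 = |ω τ x y| * |ω τ x y| := by rw [← sq, sq_abs]
        _ ≤ C * (C * Real.exp (-k * |y|)) := mul_le_mul h2 h1 (abs_nonneg _) hC
        _ = C ^ 2 * Real.exp (-k * |y|) := by ring
    · refine integrableOn_strip_of_abs_le_sq_exp ((cω hτ0).abs.mul (kato_phi_contDiff.continuous.comp continuous_snd))
        hk (C := C) fun x _ y => ?_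
      rw [abs_mul, abs_abs, abs_of_nonneg (kato_phi_pos y).le]
      calc |ω τ x y| * Real.sqrt (1 + y ^ 2) ≤ C * Real.exp (-k * |y|) * (1 + |y|) :=
            mul_le_mul (hωb x y) (kato_phi_le y) (kato_phi_pos y).le (by positivity)
        _ ≤ C * Real.exp (-k * |y|) * (1 + |y|) ^ 2 := by
            refine mul_le_mul_of_nonneg_left ?_ (by positivity)
            nlinarith [abs_nonneg y]
        _ = C * ((1 + |y|) ^ 2 * Real.exp (-k * |y|)) := by ring
  -- `A₀` from Kato
  set A₀ : ℝ := (∫ q in Ioc 0 L ×ˢ univ, |ω (1 / 2) q.1 q.2|) + 1 with hA₀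
  have hA₀0 : 0 ≤ A₀ := by
    have : 0 ≤ ∫ q in Ioc 0 L ×ˢ univ, |ω (1 / 2) q.1 q.2| := setIntegral_nonneg hS fun q _ => abs_nonneg _
    linarith
  have hL1 : ∀ {τ : ℝ}, 1 / 2 ≤ τ → ∫ q in Ioc 0 L ×ˢ univ, |ω τ q.1 q.2| ≤ A₀ := by
    intro τ hτ
    obtain ⟨-, -, -, -, -, -, iτ, -, -⟩ := hfacts (a := 1 / 4) (b := τ + 1) (τ := τ) (by norm_num) (by linarith)
      ⟨by linarith, by linarith⟩
    obtain ⟨-, -, -, -, -, -, ih, -, -⟩ := hfacts (a := 1 / 4) (b := τ + 1) (τ := 1 / 2) (by norm_num) (by linarith)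
      ⟨by norm_num, by linarith⟩
    have h := stub_vorticityUniformBounds_kato ν L hν hL u v p hsol htails (1 / 2) τ (by norm_num) hτ
    rw [integral_iterated_eq_strip iτ, integral_iterated_eq_strip ih] at h
    simp only [hA₀]
    linarith
  -- `B` from the enstrophy bound
  obtain ⟨B, hB⟩ := stub_vorticityUniformBounds_enstrophy ν L hν hL u v p hsol htails
  set B' : ℝ := max B 0 with hB'
  have hB'0 : 0 ≤ B' := le_max_right _ _
  have hL2 : ∀ {τ : ℝ}, 1 ≤ τ → ∫ q in Ioc 0 L ×ˢ univ, ω τ q.1 q.2 ^ 2 ≤ B' := by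
    intro τ hτ
    obtain ⟨-, -, -, -, -, -, -, i2, -⟩ := hfacts (a := 1 / 2) (b := τ + 1) (τ := τ) (by norm_num) (by linarith)
      ⟨by linarith, by linarith⟩
    have h := hB τ hτ
    rw [integral_iterated_eq_strip i2] at h
    exact h.trans (le_max_left _ _)
  -- constants
  set K₀ : ℝ := L / (2 * Real.pi) * B' + (1 + ν) * A₀ with hK₀
  set M₁ : ℝ := ∫ q in Ioc 0 L ×ˢ univ, |ω 1 q.1 q.2| * Real.sqrt (1 + q.2 ^ 2) with hM₁
  set Mfin : ℝ := max (M₁ + 1) (K₀ + 1) with hMfin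
  refine ⟨Mfin, fun t ht => ?_⟩
  obtain ⟨Ct, kt, hkt, hCt, hTt, hωbt, iω1, iω2, iωφ⟩ := hfacts (a := 1 / 2) (b := t + 1) (τ := t) (by norm_num)
    (by linarith) ⟨by linarith, by linarith⟩
  -- reduce to `∫∫ |ω(t)| φ ≤ Mfin`
  have ht0 : 0 < t := by linarith
  have iyω : IntegrableOn (fun q : ℝ × ℝ => |q.2| * |ω t q.1 q.2|) (Ioc 0 L ×ˢ univ) := by
    refine Integrable.mono' iωφ (by exact ((continuous_abs.comp continuous_snd).mul (cω ht0).abs).aestronglyMeasurable)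
      (Eventually.of_forall fun q => ?_)
    rw [Real.norm_eq_abs, abs_mul, abs_abs, abs_abs, mul_comm]
    exact mul_le_mul_of_nonneg_left (kato_abs_le_phi q.2) (abs_nonneg _)
  rw [integral_iterated_eq_strip iyω]
  suffices hmain : ∫ q in Ioc 0 L ×ˢ univ, |ω t q.1 q.2| * Real.sqrt (1 + q.2 ^ 2) ≤ Mfin by
    refine (integral_mono iyω iωφ fun q => ?_).trans hmain
    simp only; rw [mul_comm]
    exact mul_le_mul_of_nonneg_left (kato_abs_le_phi q.2) (abs_nonneg _)
  rcases eq_or_lt_of_le ht with rfl | ht1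
  · exact (by linarith : M₁ ≤ M₁ + 1).trans (le_max_left _ _)
  -- tails on `[1/2, t+1]`, the cutoff constants, the error constants
  obtain ⟨C, k, hk, hCk⟩ := htails (1 / 2) (t + 1) (by norm_num) (by linarith)
  have hST : ∀ τ ∈ Icc (1 / 2) (t + 1), SliceTails C k (u τ) (v τ) := fun τ hτ => (hCk τ hτ).1
  have hC : 0 ≤ C := (hST 1 ⟨by norm_num, by linarith⟩).nonneg
  obtain ⟨Cσ, hCσ0, hCσ⟩ := kato_smoothTransition_deriv_bound
  set Ik : ℝ := ∫ q in Ioc 0 L ×ˢ univ, Real.exp (-k * |q.2|) with hIk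
  set Ik2 : ℝ := ∫ q in Ioc 0 L ×ˢ univ, Real.exp (-(k / 2) * |q.2|) with hIk2
  have hIk0 : 0 ≤ Ik := setIntegral_nonneg hS fun q _ => (Real.exp_pos _).le
  have hIk20 : 0 ≤ Ik2 := setIntegral_nonneg hS fun q _ => (Real.exp_pos _).le
  set acst : ℝ := 2 * ν * C * Cσ * Ik + 8 * Cσ * C ^ 2 / k * Ik + 384 * Cσ * C / k ^ 2 * Ik2 + 16 * ν * Cσ * C / k * Ik2
    with hacst
  have hacst0 : 0 ≤ acst := by positivity
  -- the claim at a fixed large cutoff level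
  have hclaim : ∀ R : ℝ, max 1 (2 * acst) ≤ R → ∫ q in Ioc 0 L ×ˢ univ, |ω t q.1 q.2| * Real.sqrt (1 + q.2 ^ 2) *
      (Real.smoothTransition (2 - q.2 / R) * Real.smoothTransition (2 + q.2 / R)) ≤ Mfin := by
    intro R hR
    have hR1 : 1 ≤ R := (le_max_left _ _).trans hR
    have hR0 : 0 < R := one_pos.trans_le hR1
    have haR : (1 / R) * acst ≤ 1 / 2 := by
      rw [one_div, inv_mul_le_iff₀ hR0]; linarith [(le_max_right _ _).trans hR]
    set ψ : ℝ → ℝ := fun y => Real.smoothTransition (2 - y / R) * Real.smoothTransition (2 + y / R) with hψdef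
    have hψ : ContDiff ℝ 1 ψ := kato_cutoff_contDiff R
    have hψ0 : ∀ y, 0 ≤ ψ y := fun y => kato_cutoff_nonneg R y
    have hψ1 : ∀ y, ψ y ≤ 1 := fun y => kato_cutoff_le_one R y
    have hψR : ∀ y, 2 * R ≤ |y| → ψ y = 0 := fun y hy => kato_cutoff_eq_zero hR0 hy
    have hψ'b : ∀ y, |deriv ψ y| ≤ 2 * Cσ / R := fun y => kato_cutoff_deriv_bound hR0 hCσ y
    have hψ'lt : ∀ y, |y| < R → deriv ψ y = 0 := fun y hy => kato_cutoff_deriv_eq_zero_of_lt hR0 hy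
    have hψ'gt : ∀ y, 2 * R < |y| → deriv ψ y = 0 := fun y hy => kato_cutoff_deriv_eq_zero_of_gt hR0 hy
    set θ : ℝ → ℝ := fun y => Real.sqrt (1 + y ^ 2) * ψ y with hθdef
    have hθ : ContDiff ℝ 1 θ := kato_phi_contDiff.mul hψ
    have hθb : ∀ y, |θ y| ≤ 1 + 2 * R := fun y => by
      simp only [hθdef]
      by_cases hy : 2 * R ≤ |y|
      · rw [hψR y hy, mul_zero, abs_zero]; positivity
      · rw [abs_mul, abs_of_nonneg (kato_phi_pos y).le, abs_of_nonneg (hψ0 y)]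
        calc Real.sqrt (1 + y ^ 2) * ψ y ≤ (1 + |y|) * 1 := mul_le_mul (kato_phi_le y) (hψ1 y) (hψ0 y) (by positivity)
          _ ≤ 1 + 2 * R := by linarith [not_le.1 hy]
    have hθR : ∀ y, 2 * R ≤ |y| → θ y = 0 := fun y hy => by simp only [hθdef, hψR y hy, mul_zero]
    -- `b(R)`, `Z(R)` and the choice of `ε`
    set IR : ℝ := ∫ q in Ioc 0 L ×ˢ univ, Real.exp (-(1 / R) * |q.2|) with hIR
    have hIR0 : 0 ≤ IR := setIntegral_nonneg hS fun q _ => (Real.exp_pos _).le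
    set bcst : ℝ := C * Ik + (1 + ν) * Real.exp 3 * IR + 2 * ν * Cσ * Real.exp 3 * IR + 8 * Cσ * C * Ik +
      24 * Cσ * R * Real.exp 3 * IR with hbcst
    have hbcst0 : 0 ≤ bcst := by positivity
    set Z : ℝ := ∫ q in Ioc 0 L ×ˢ univ, θ q.2 with hZ
    have cθ : Continuous θ := hθ.continuous
    have iZ : IntegrableOn (fun q : ℝ × ℝ => θ q.2) (Ioc 0 L ×ˢ univ) :=
      kato_integrableOn_strip_of_eq_zero (R := 2 * R) (cθ.comp continuous_snd) fun x _ y hy => hθR y hy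
    have hθ0 : ∀ y, 0 ≤ θ y := fun y => mul_nonneg (kato_phi_pos y).le (hψ0 y)
    have hZ0 : 0 ≤ Z := setIntegral_nonneg hS fun q _ => hθ0 _
    obtain ⟨ε, hεdef⟩ : ∃ ε : ℝ, ε = 1 / (2 * bcst + 2 * Z + 2) := ⟨_, rfl⟩
    have hden : 0 < 2 * bcst + 2 * Z + 2 := by positivity
    have hε : 0 < ε := by rw [hεdef]; positivity
    have hεb : ε * bcst ≤ 1 / 2 := by
      rw [hεdef, div_mul_eq_mul_div, one_mul, div_le_iff₀ hden]; linarith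
    have hεZ : ε * Z ≤ 1 / 2 := by
      rw [hεdef, div_mul_eq_mul_div, one_mul, div_le_iff₀ hden]; linarith
    -- the functional and its derivative
    obtain ⟨f, hf⟩ : ∃ f : ℝ → ℝ, f = fun τ => ∫ q in Ioc 0 L ×ˢ univ, Real.sqrt (ω τ q.1 q.2 ^ 2 + ε ^ 2) * θ q.2 :=
      ⟨_, rfl⟩
    have hderiv : ∀ τ ∈ Ioo (1 / 2) (t + 1), HasDerivAt f (∫ q in Ioc 0 L ×ˢ univ, ω τ q.1 q.2 /
        Real.sqrt (ω τ q.1 q.2 ^ 2 + ε ^ 2) * θ q.2 *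
        (dX (fun x y => deriv (fun s => v s x y) τ) q.1 q.2 - dY (fun x y => deriv (fun s => u s x y) τ) q.1 q.2)) τ := by
      intro τ hτ
      rw [hf]
      exact kato_hasDerivAt_weightedL1 hsol.contDiffOn_u hsol.contDiffOn_v hε hθ (by positivity) hθb hθR L
        (by norm_num : (0:ℝ) < 1 / 2) hτ
    have hcont : ContinuousOn f (Icc 1 t) := fun τ hτ =>
      (hderiv τ ⟨by linarith [hτ.1], by linarith [hτ.2]⟩).continuousAt.continuousWithinAt
    have hneg : ∀ τ ∈ Ioc 1 t, K₀ + 1 < f τ → ∃ D', HasDerivAt f D' τ ∧ D' < 0 := by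
      intro τ hτ hKf
      have hτI : τ ∈ Ioo (1 / 2) (t + 1) := ⟨by linarith [hτ.1], by linarith [hτ.2]⟩
      have hτ0 : 0 < τ := by linarith [hτ.1]
      have hτ' : τ ∈ Ioi (0:ℝ) := hτ0
      refine ⟨_, hderiv τ hτI, ?_⟩
      have hTτ := hST τ ⟨by linarith [hτ.1], by linarith [hτ.2]⟩
      have hu2 := hsol.contDiff_u hτ'; have hv2 := hsol.contDiff_v hτ'
      have hdivτ := hsol.divFree τ hτ'
      have hω1 : ContDiff ℝ 1 (fun q : ℝ × ℝ => ω τ q.1 q.2) := contDiff_one_vorticity hu2 hv2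
      -- the moment balance (tools R)
      have hslice := stub_vorticityUniformBounds_momentSlice L ν (2 * R) ε (u τ) (v τ) (p τ)
        (fun x y => deriv (fun s => u s x y) τ) (fun x y => deriv (fun s => v s x y) τ) ψ hL hν.le hε
        hu2 hv2 (hsol.contDiff_p hτ')
        (kato_contDiff_deriv_time_slice hsol.contDiffOn_u hτ0) (kato_contDiff_deriv_time_slice hsol.contDiffOn_v hτ0)
        (fun x y => by
          have h := hsol.momentum_x τ hτ' x y
          rw [dT_of_isOpen isOpen_Ioi u hτ', one_mul] at h; exact h)
        (fun x y => by
          have h := hsol.momentum_y τ hτ' x y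
          rw [dT_of_isOpen isOpen_Ioi v hτ', one_mul, one_mul] at h; exact h)
        hdivτ (hsol.periodic_u τ hτ') (hsol.periodic_v τ hτ') (hsol.periodic_p τ hτ')
        (fun x y => kato_deriv_time_periodic (fun s hs x y => hsol.periodic_v s hs x y) hτ0 x y) hψ hψ0 hψ1 hψR
      -- the error terms (tools S)
      have hωb : ∀ x y, |ω τ x y| ≤ C * Real.exp (-k * |y|) := tails_abs_vorticity_le hTτ
      have hωyb : ∀ x y, |dY (ω τ) x y| ≤ C * Real.exp (-k * |y|) := kato_abs_dY_vorticity_le hTτ hu2 hv2 hdivτ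
      have hvb : ∀ x y, |v τ x y| ≤ C * Real.exp (-k * |y|) := fun x y => hTτ.abs_v_le x y
      have herr := stub_vorticityUniformBounds_momentErr (L := L) hk hC hν.le hε.le hR1 hCσ0 (ω := fun q => ω τ q.1 q.2)
        (vv := fun q => v τ q.1 q.2) (ωy := fun q => dY (ω τ) q.1 q.2) (cω hτ0) hv2.continuous (continuous_dY hω1)
        (fun q => hωb q.1 q.2) (fun q => hvb q.1 q.2) (fun q => hωyb q.1 q.2) hψ hψ0 hψ1 hψR hψ'b hψ'lt hψ'gt
      -- the two main terms: `∫(|ω|+ε)|v|ψ ≤ (L/2π)B' + ε∫|v|ψ` and `∫(|ω|+ε)ψ ≤ A₀ + ε∫ψ`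
      have cψ : Continuous ψ := hψ.continuous
      have iψ : ∀ F : ℝ × ℝ → ℝ, Continuous F → IntegrableOn (fun q : ℝ × ℝ => F q * ψ q.2) (Ioc 0 L ×ˢ univ) :=
        fun F hF => kato_integrableOn_strip_of_eq_zero (R := 2 * R) (hF.mul (cψ.comp continuous_snd))
          fun x _ y hy => by simp only [hψR y hy, mul_zero]
      obtain ⟨-, -, -, -, -, -, iωτ, iω2τ, -⟩ := hfacts (a := 1 / 2) (b := t + 1) (τ := τ) (by norm_num) (by linarith)
        ⟨by linarith [hτ.1], by linarith [hτ.2]⟩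
      have iv2 : IntegrableOn (fun q : ℝ × ℝ => v τ q.1 q.2 ^ 2) (Ioc 0 L ×ˢ univ) := by
        refine integrableOn_strip_of_abs_le_exp (hv2.continuous.pow 2) (by positivity : 0 ≤ C ^ 2) hk fun x _ y => ?_
        rw [abs_of_nonneg (sq_nonneg _)]
        have h1 := hvb x y
        have h2 : |v τ x y| ≤ C := h1.trans (mul_le_of_le_one_right hC (hle1 y hk))
        calc v τ x y ^ 2 = |v τ x y| * |v τ x y| := by rw [← sq, sq_abs]
          _ ≤ C * (C * Real.exp (-k * |y|)) := mul_le_mul h2 h1 (abs_nonneg _) hC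
          _ = C ^ 2 * Real.exp (-k * |y|) := by ring
      have hX1 : ∫ q in Ioc 0 L ×ˢ univ, (|ω τ q.1 q.2| + ε) * |v τ q.1 q.2| * ψ q.2 ≤
          L / (2 * Real.pi) * B' + ε * ∫ q in Ioc 0 L ×ˢ univ, |v τ q.1 q.2| * ψ q.2 := by
        have iωv : IntegrableOn (fun q : ℝ × ℝ => |ω τ q.1 q.2| * |v τ q.1 q.2|) (Ioc 0 L ×ˢ univ) := by
          refine integrableOn_strip_of_abs_le_exp ((cω hτ0).abs.mul hv2.continuous.abs) (by positivity : 0 ≤ C ^ 2) hk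
            fun x _ y => ?_
          rw [abs_mul, abs_abs, abs_abs]
          have h2 : |ω τ x y| ≤ C := (hωb x y).trans (mul_le_of_le_one_right hC (hle1 y hk))
          calc |ω τ x y| * |v τ x y| ≤ C * (C * Real.exp (-k * |y|)) := mul_le_mul h2 (hvb x y) (abs_nonneg _) hC
            _ = C ^ 2 * Real.exp (-k * |y|) := by ring
        have ivψ := iψ (fun q => |v τ q.1 q.2|) hv2.continuous.abs
        have h1 : ∫ q in Ioc 0 L ×ˢ univ, (|ω τ q.1 q.2| + ε) * |v τ q.1 q.2| * ψ q.2 ≤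
            (∫ q in Ioc 0 L ×ˢ univ, |ω τ q.1 q.2| * |v τ q.1 q.2|) + ε * ∫ q in Ioc 0 L ×ˢ univ, |v τ q.1 q.2| * ψ q.2 := by
          rw [← integral_const_mul, ← integral_add iωv (ivψ.const_mul ε)]
          refine integral_mono (iψ (fun q => (|ω τ q.1 q.2| + ε) * |v τ q.1 q.2|) (by fun_prop)) (iωv.add (ivψ.const_mul ε))
            fun q => ?_
          simp only
          calc (|ω τ q.1 q.2| + ε) * |v τ q.1 q.2| * ψ q.2 = |ω τ q.1 q.2| * |v τ q.1 q.2| * ψ q.2 + ε * (|v τ q.1 q.2| * ψ q.2) := by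
                ring
            _ ≤ |ω τ q.1 q.2| * |v τ q.1 q.2| + ε * (|v τ q.1 q.2| * ψ q.2) :=
                add_le_add (mul_le_of_le_one_right (mul_nonneg (abs_nonneg _) (abs_nonneg _)) (hψ1 _)) le_rfl
        -- Cauchy–Schwarz and `‖v‖₂² ≤ (L/2π)²‖ω‖₂² ≤ (L/2π)² B'`
        have hcs := kato_strip_cauchySchwarz (L := L) (φ := fun q => ω τ q.1 q.2) (χ := fun q => v τ q.1 q.2)
          (cω hτ0) hv2.continuous iω2τ iv2
        have hv2le := kato_integral_v_sq_le hL hk hTτ hu2 hv2 hdivτ (hsol.periodic_u τ hτ') (hsol.periodic_v τ hτ')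
        have hΩ := hL2 (le_of_lt hτ.1)
        have hs1 : Real.sqrt (∫ q in Ioc 0 L ×ˢ univ, ω τ q.1 q.2 ^ 2) ≤ Real.sqrt B' := Real.sqrt_le_sqrt hΩ
        have hs2 : Real.sqrt (∫ q in Ioc 0 L ×ˢ univ, v τ q.1 q.2 ^ 2) ≤ L / (2 * Real.pi) * Real.sqrt B' := by
          calc Real.sqrt (∫ q in Ioc 0 L ×ˢ univ, v τ q.1 q.2 ^ 2) ≤ Real.sqrt ((L / (2 * Real.pi)) ^ 2 * B') :=
                Real.sqrt_le_sqrt (hv2le.trans (mul_le_mul_of_nonneg_left hΩ (sq_nonneg _)))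
            _ = L / (2 * Real.pi) * Real.sqrt B' := by
                rw [Real.sqrt_mul (sq_nonneg _), Real.sqrt_sq (by positivity)]
        have hs3 : Real.sqrt (∫ q in Ioc 0 L ×ˢ univ, ω τ q.1 q.2 ^ 2) * Real.sqrt (∫ q in Ioc 0 L ×ˢ univ, v τ q.1 q.2 ^ 2) ≤
            Real.sqrt B' * (L / (2 * Real.pi) * Real.sqrt B') :=
          mul_le_mul hs1 hs2 (Real.sqrt_nonneg _) (Real.sqrt_nonneg _)
        have hs4 : Real.sqrt B' * (L / (2 * Real.pi) * Real.sqrt B') = L / (2 * Real.pi) * B' := by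
          rw [show Real.sqrt B' * (L / (2 * Real.pi) * Real.sqrt B') = L / (2 * Real.pi) * (Real.sqrt B' * Real.sqrt B') by ring,
            Real.mul_self_sqrt hB'0]
        have e : ∫ q in Ioc 0 L ×ˢ univ, |ω τ q.1 q.2| * |v τ q.1 q.2| = ∫ q in Ioc 0 L ×ˢ univ, |(fun q : ℝ × ℝ => ω τ q.1 q.2) q| *
            |(fun q : ℝ × ℝ => v τ q.1 q.2) q| := rfl
        linarith [h1, hcs, hs3, hs4, e]
      have hX2 : ∫ q in Ioc 0 L ×ˢ univ, (|ω τ q.1 q.2| + ε) * ψ q.2 ≤ A₀ + ε * ∫ q in Ioc 0 L ×ˢ univ, ψ q.2 := by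
        have iψ1 : IntegrableOn (fun q : ℝ × ℝ => ψ q.2) (Ioc 0 L ×ˢ univ) := by
          have := iψ (fun _ => (1:ℝ)) continuous_const; simp only [one_mul] at this; exact this
        have h1 : ∫ q in Ioc 0 L ×ˢ univ, (|ω τ q.1 q.2| + ε) * ψ q.2 ≤
            (∫ q in Ioc 0 L ×ˢ univ, |ω τ q.1 q.2|) + ε * ∫ q in Ioc 0 L ×ˢ univ, ψ q.2 := by
          rw [← integral_const_mul, ← integral_add iωτ (iψ1.const_mul ε)]
          refine integral_mono (iψ (fun q => |ω τ q.1 q.2| + ε) (by fun_prop)) (iωτ.add (iψ1.const_mul ε)) fun q => ?_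
          simp only
          calc (|ω τ q.1 q.2| + ε) * ψ q.2 = |ω τ q.1 q.2| * ψ q.2 + ε * ψ q.2 := by ring
            _ ≤ |ω τ q.1 q.2| + ε * ψ q.2 := add_le_add (mul_le_of_le_one_right (abs_nonneg _) (hψ1 _)) le_rfl
        linarith [h1, hL1 (by linarith [hτ.1] : 1 / 2 ≤ τ)]
      -- `−Mval = −f τ`
      have eM : ∫ q in Ioc 0 L ×ˢ univ, Real.sqrt (ω τ q.1 q.2 ^ 2 + ε ^ 2) * Real.sqrt (1 + q.2 ^ 2) * ψ q.2 = f τ := by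
        rw [hf]; simp only [hθdef]; exact integral_congr_ae (Eventually.of_forall fun q => by simp only; ring)
      -- assemble: `D′ ≤ −f τ + K₀ + (a/R + εb) ≤ −f τ + K₀ + 1 < 0`
      have hmain : ∫ q in Ioc 0 L ×ˢ univ, ω τ q.1 q.2 / Real.sqrt (ω τ q.1 q.2 ^ 2 + ε ^ 2) * θ q.2 *
          (dX (fun x y => deriv (fun s => v s x y) τ) q.1 q.2 - dY (fun x y => deriv (fun s => u s x y) τ) q.1 q.2) ≤
          -f τ + K₀ + ((1 / R) * acst + ε * bcst) := by
        have e1 : ∫ q in Ioc 0 L ×ˢ univ, ω τ q.1 q.2 / Real.sqrt (ω τ q.1 q.2 ^ 2 + ε ^ 2) * θ q.2 *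
            (dX (fun x y => deriv (fun s => v s x y) τ) q.1 q.2 - dY (fun x y => deriv (fun s => u s x y) τ) q.1 q.2) =
            ∫ q in Ioc 0 L ×ˢ univ, vorticity (u τ) (v τ) q.1 q.2 / Real.sqrt (vorticity (u τ) (v τ) q.1 q.2 ^ 2 + ε ^ 2) *
              (Real.sqrt (1 + q.2 ^ 2) * ψ q.2) *
              (dX (fun x y => deriv (fun s => v s x y) τ) q.1 q.2 - dY (fun x y => deriv (fun s => u s x y) τ) q.1 q.2) := rfl
        rw [e1]
        simp only [hK₀, hacst, hbcst]
        have hX2' := mul_le_mul_of_nonneg_left hX2 (by positivity : (0:ℝ) ≤ 1 + ν)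
        have e2 : (1 + ν) * (A₀ + ε * ∫ q in Ioc 0 L ×ˢ univ, ψ q.2) =
            (1 + ν) * A₀ + (1 + ν) * (ε * ∫ q in Ioc 0 L ×ˢ univ, ψ q.2) := by ring
        linarith [hslice, herr, hX1, hX2', eM, e2]
      have hsmall : (1 / R) * acst + ε * bcst ≤ 1 := by linarith [haR, hεb]
      linarith [hmain, hsmall, hKf]
    -- the barrier on `[1, t]`
    have hbar := kato_barrier_Icc hcont hneg (right_mem_Icc.2 ht1.le)
    -- `f 1 ≤ M₁ + 1/2`
    have hf1 : f 1 ≤ M₁ + 1 / 2 := by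
      obtain ⟨-, -, -, -, -, -, -, -, iφ1⟩ := hfacts (a := 1 / 2) (b := t + 1) (τ := 1) (by norm_num) (by linarith)
        ⟨by norm_num, by linarith⟩
      have i1 : IntegrableOn (fun q : ℝ × ℝ => |ω 1 q.1 q.2| * Real.sqrt (1 + q.2 ^ 2) * ψ q.2) (Ioc 0 L ×ˢ univ) :=
        kato_integrableOn_strip_of_eq_zero (R := 2 * R) (((cω one_pos).abs.mul
          (kato_phi_contDiff.continuous.comp continuous_snd)).mul (hψ.continuous.comp continuous_snd))
          fun x _ y hy => by simp only [hψR y hy, mul_zero]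
      have if1 : IntegrableOn (fun q : ℝ × ℝ => Real.sqrt (ω 1 q.1 q.2 ^ 2 + ε ^ 2) * θ q.2) (Ioc 0 L ×ˢ univ) :=
        kato_integrableOn_strip_of_eq_zero (R := 2 * R)
          ((Real.continuous_sqrt.comp (((cω one_pos).pow 2).add continuous_const)).mul (cθ.comp continuous_snd))
          fun x _ y hy => by simp only [hθR y hy, mul_zero]
      have h1 : f 1 ≤ (∫ q in Ioc 0 L ×ˢ univ, |ω 1 q.1 q.2| * Real.sqrt (1 + q.2 ^ 2) * ψ q.2) + ε * Z := by
        rw [hf]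
        simp only [hZ]
        rw [← integral_const_mul, ← integral_add i1 (iZ.const_mul ε)]
        refine integral_mono if1 (i1.add (iZ.const_mul ε)) fun q => ?_
        simp only [hθdef]
        have h := kato_sqrt_le hε (ω 1 q.1 q.2)
        have h0 : 0 ≤ Real.sqrt (1 + q.2 ^ 2) * ψ q.2 := hθ0 q.2
        calc Real.sqrt (ω 1 q.1 q.2 ^ 2 + ε ^ 2) * (Real.sqrt (1 + q.2 ^ 2) * ψ q.2) ≤
            (|ω 1 q.1 q.2| + ε) * (Real.sqrt (1 + q.2 ^ 2) * ψ q.2) := mul_le_mul_of_nonneg_right h h0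
          _ = |ω 1 q.1 q.2| * Real.sqrt (1 + q.2 ^ 2) * ψ q.2 + ε * (Real.sqrt (1 + q.2 ^ 2) * ψ q.2) := by ring
      have h2 : ∫ q in Ioc 0 L ×ˢ univ, |ω 1 q.1 q.2| * Real.sqrt (1 + q.2 ^ 2) * ψ q.2 ≤ M₁ := by
        refine integral_mono i1 iφ1 fun q => ?_
        exact mul_le_of_le_one_right (mul_nonneg (abs_nonneg _) (kato_phi_pos _).le) (hψ1 _)
      linarith [hεZ]
    -- `∫∫ |ω(t)|φψ ≤ f t ≤ max (f 1) (K₀+1) ≤ Mfin`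
    have hlow : ∫ q in Ioc 0 L ×ˢ univ, |ω t q.1 q.2| * Real.sqrt (1 + q.2 ^ 2) * ψ q.2 ≤ f t := by
      have i1 : IntegrableOn (fun q : ℝ × ℝ => |ω t q.1 q.2| * Real.sqrt (1 + q.2 ^ 2) * ψ q.2) (Ioc 0 L ×ˢ univ) :=
        kato_integrableOn_strip_of_eq_zero (R := 2 * R) (((cω ht0).abs.mul
          (kato_phi_contDiff.continuous.comp continuous_snd)).mul (hψ.continuous.comp continuous_snd))
          fun x _ y hy => by simp only [hψR y hy, mul_zero]
      have if1 : IntegrableOn (fun q : ℝ × ℝ => Real.sqrt (ω t q.1 q.2 ^ 2 + ε ^ 2) * θ q.2) (Ioc 0 L ×ˢ univ) :=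
        kato_integrableOn_strip_of_eq_zero (R := 2 * R)
          ((Real.continuous_sqrt.comp (((cω ht0).pow 2).add continuous_const)).mul (cθ.comp continuous_snd))
          fun x _ y hy => by simp only [hθR y hy, mul_zero]
      rw [hf]
      refine integral_mono i1 if1 fun q => ?_
      simp only [hθdef]
      have h := kato_abs_le_sqrt (ω t q.1 q.2) ε
      have h0 : 0 ≤ Real.sqrt (1 + q.2 ^ 2) * ψ q.2 := hθ0 q.2
      calc |ω t q.1 q.2| * Real.sqrt (1 + q.2 ^ 2) * ψ q.2 = |ω t q.1 q.2| * (Real.sqrt (1 + q.2 ^ 2) * ψ q.2) := by ring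
        _ ≤ Real.sqrt (ω t q.1 q.2 ^ 2 + ε ^ 2) * (Real.sqrt (1 + q.2 ^ 2) * ψ q.2) := mul_le_mul_of_nonneg_right h h0
    calc ∫ q in Ioc 0 L ×ˢ univ, |ω t q.1 q.2| * Real.sqrt (1 + q.2 ^ 2) * ψ q.2 ≤ f t := hlow
      _ ≤ max (f 1) (K₀ + 1) := hbar
      _ ≤ Mfin := max_le_max (by linarith) le_rfl
  -- `R → ∞`
  have hlim : Tendsto (fun R : ℝ => ∫ q in Ioc 0 L ×ˢ univ, |ω t q.1 q.2| * Real.sqrt (1 + q.2 ^ 2) *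
      (Real.smoothTransition (2 - q.2 / R) * Real.smoothTransition (2 + q.2 / R))) atTop
      (𝓝 (∫ q in Ioc 0 L ×ˢ univ, |ω t q.1 q.2| * Real.sqrt (1 + q.2 ^ 2))) := by
    refine tendsto_integral_filter_of_dominated_convergence (fun q => |ω t q.1 q.2| * Real.sqrt (1 + q.2 ^ 2)) ?_ ?_ iωφ ?_
    · exact Eventually.of_forall fun R => ((((cω ht0).abs.mul (kato_phi_contDiff.continuous.comp continuous_snd))).mul
        ((kato_cutoff_contDiff R).continuous.comp continuous_snd)).aestronglyMeasurable
    · refine Eventually.of_forall fun R => Eventually.of_forall fun q => ?_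
      rw [Real.norm_eq_abs, abs_mul, abs_of_nonneg (mul_nonneg (abs_nonneg _) (kato_phi_pos _).le)]
      exact mul_le_of_le_one_right (mul_nonneg (abs_nonneg _) (kato_phi_pos _).le) (kato_cutoff_abs_le_one R q.2)
    · refine Eventually.of_forall fun q => tendsto_const_nhds.congr' ?_
      filter_upwards [eventually_ge_atTop |q.2|, eventually_gt_atTop (0:ℝ)] with R h1 h2
      rw [kato_cutoff_eq_one h2 h1, mul_one]
  exact le_of_tendsto hlim (by
    filter_upwards [eventually_ge_atTop (max 1 (2 * acst))] with R hR
    exact hclaim R hR)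

end Moment

end Summit.AnomalousDissipation.AnomalousDissipation.Theorems.StrainedLayerLaw.StrainWorkSumRule

end
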